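import Summits.RiemannHypothesis.RiemannHypothesis.Theorems.SuzukiStructureFunctionsStructContinuity
import Summits.RiemannHypothesis.RiemannHypothesis.Theorems.SuzukiStructureFunctionsZetaPair
import Literature.NumberTheory.LFunctions.SuzukiConditionalWindowsProofs

/-!
# SuzukiStructureFunctionsZetaDynamics — the continuous Hamiltonian on clean ranges, and Suzuki's Thm. 2.2 dynamics
# data for `ζ`: `E_ζ^{ω,ν}(t,z)`, `μ`, `m`, `H` continuous in `t ∈ [0,∞)`, `m′ = μm` (column DBR; RH-FREE)

LINE 1 — LABEL: RH-FREE (ζ enters only through the tree's unconditional windows `suzuki2021_windows_of_half_le'` and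
Prop. 4.1; no zeros, no positivity); bears_on LADDER-RH B-D → B-P(P1)/(P3): for `ω ≥ ½`, `ν ≥ 1`, `νω > 1` Suzuki's
canonical-system data of Thm. 2.2 — the structure function `E_ζ^{ω,ν}(t,·)` (entire in `z`) and the Hamiltonian
`H_ζ^{ω,ν}(t) = diag(m⁻², m²)` — exist in the kernel as CONTINUOUS functions of `t` on the whole half-line, with `m′ = μm`.
WHAT THIS IS NOT: not progress toward RH; the canonical system itself (Thm. 3.1 (4) / Thm. 2.2's ODE) and
`lim J(t;z,z) = 0` (Thm. 2.4, GRH-equivalent as `ω → 0`) are NOT claimed.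

Source: M. Suzuki, J. Funct. Anal. 281 (2021) 109116 = arXiv:1606.05726 [Suzuki2021Hamiltonians], Thm. 2.2, Thm. 3.1 (2),
(3.32)–(3.33), Prop. 2.2 + Prop. 4.4 (windows for `ω ≥ ½`).

Contents (seat rh-dbr-eng-5 g7): `continuousOn_hamiltonian_Ico` (general clean ranges); for `ζ`:
**`continuousOn_suzukiEt`**, `continuousOn_mu_suzukiKernel`, **`continuousOn_m_suzukiKernel`**, `hasDerivAt_m_suzukiKernel`,
`continuousOn_hamiltonian_suzukiKernel`.
-/

noncomputable section

-- D-0017: `Summit.<S>.<S>.…` is the designed namespace of a single-problem summit.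
set_option linter.dupNamespace false

open MeasureTheory Set Filter Topology Function Complex

namespace Summit.RiemannHypothesis.RiemannHypothesis.Theorems.SuzukiStructureFunctions

open Literature.NumberTheory.LFunctions Literature.NumberTheory.LFunctions.SuzukiStructure

variable {ϱ K : ℝ → ℝ} {t : ℝ}

/-! ## §19 The Hamiltonian is continuous on clean ranges; Suzuki's Thm. 2.2 dynamics data for `ζ`:
`E_ζ^{ω,ν}(t,z)`, `m`, `H` continuous in `t ≥ 0`, `m′ = μm` (ω ≥ ½, ν ≥ 1, νω > 1; unconditional) -/

/-- RH-FREE. **`γ = m²` and the Hamiltonian `H(t) = diag(1/γ, γ)` are continuous on every clean range `[0,τ)`**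
(entrywise; «`H(t)` is a Hamiltonian on `[0,τ)` consisting of continuous functions», §3.6). -/
theorem continuousOn_hamiltonian_Ico (hK : Continuous K) (hK0 : ∀ u : ℝ, u ≤ 0 → K u = 0) {τ : ℝ}
    (hclean : ∀ s : ℝ, s ∈ Ico 0 τ → NoUnitEigenvalue K s) (i j : Fin 2) :
    ContinuousOn (fun t : ℝ => hamiltonian K t i j) (Ico 0 τ) := by
  have hm := continuousOn_m_Ico hK hK0 hclean
  have hγ : ContinuousOn (gamma K) (Ico 0 τ) := by
    have e : gamma K = fun t => m K t ^ 2 := by funext t; rfl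
    rw [e]; exact hm.pow 2
  have hγinv : ContinuousOn (fun t => 1 / gamma K t) (Ico 0 τ) :=
    continuousOn_const.div hγ fun t _ => (gamma_pos K t).ne'
  fin_cases i <;> fin_cases j
  · simpa [hamiltonian] using hγinv
  · simpa [hamiltonian] using continuousOn_const
  · simpa [hamiltonian] using continuousOn_const
  · simpa [hamiltonian] using hγ

/-- RH-FREE. From a clean range `[0,τ)` to the half-line: a property holding within every `[0,τ)` at `t₀ < τ` holds within
`[0,∞)` (the ranges are neighbourhoods within `[0,∞)`). -/
theorem continuousWithinAt_Ici_of_Ico {α : Type*} [TopologicalSpace α] {f : ℝ → α} {t₀ : ℝ}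
    (h : ContinuousWithinAt f (Ico 0 (t₀ + 1)) t₀) : ContinuousWithinAt f (Ici 0) t₀ :=
  h.mono_of_mem_nhdsWithin (mem_nhdsWithin.2 ⟨Iio (t₀ + 1), isOpen_Iio, by simp, fun s hs => ⟨hs.2, hs.1⟩⟩)

/-- **RH-FREE · `E_ζ^{ω,ν}(t,z)` IS CONTINUOUS IN `t ∈ [0,∞)`** for every `z` (`ω ≥ ½`, `ν ≥ 1`, `νω > 1`; all windows are
clean by `suzuki2021_windows_of_half_le'`, so Thm. 3.1 (2)'s continuity applies on every `[0,τ)`). -/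
theorem continuousOn_suzukiEt {ω : ℝ} (hω : 1 / 2 ≤ ω) {ν : ℕ} (hν : 1 ≤ ν) (hνω : 1 < (ν : ℝ) * ω) (z : ℂ) :
    ContinuousOn (fun t : ℝ => suzukiEt ω ν t z) (Ici 0) := by
  intro t₀ ht₀
  have ht₀' : 0 ≤ t₀ := ht₀
  have hclean : ∀ s : ℝ, s ∈ Ico 0 (t₀ + 1) → NoUnitEigenvalue (suzukiKernel ω ν) s :=
    fun s hs => suzuki2021_windows_of_half_le' hω hν hνω hs.1
  have h := continuousOn_structE (isSuzukiPair_zeta (by linarith) hν hνω) hclean z t₀ ⟨ht₀', by linarith⟩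
  exact continuousWithinAt_Ici_of_Ico h

/-- RH-FREE. `μ_ζ^{ω,ν}(t) = φ⁺(t,t) + φ⁻(t,t)` is continuous on `[0,∞)` (`ω ≥ ½`, `ν ≥ 1`, `νω > 1`). -/
theorem continuousOn_mu_suzukiKernel {ω : ℝ} (hω : 1 / 2 ≤ ω) {ν : ℕ} (hν : 1 ≤ ν) (hνω : 1 < (ν : ℝ) * ω) :
    ContinuousOn (mu (suzukiKernel ω ν)) (Ici 0) := by
  have hK : Continuous (suzukiKernel ω ν) := suzuki2021_prop41_iv (by linarith) ν hνω
  have hK0 : ∀ u : ℝ, u ≤ 0 → suzukiKernel ω ν u = 0 := (isSuzukiPair_zeta (by linarith) hν hνω).kernel_eq_zero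
  refine (continuousOn_mu hK hK0).mono fun s hs => ⟨hs, suzuki2021_windows_of_half_le' hω hν hνω hs⟩

/-- **RH-FREE · `m_ζ^{ω,ν}` IS CONTINUOUS ON `[0,∞)` AND `m′ = μm` ON `(0,∞)`** — Suzuki's Hamiltonian
`H_ζ^{ω,ν}(t) = diag(m(t)⁻², m(t)²)` (Thm. 2.2 / (3.33)) is a continuous Hamiltonian on the whole half-line for `ω ≥ ½`,
`ν ≥ 1`, `νω > 1`, unconditionally. -/
theorem continuousOn_m_suzukiKernel {ω : ℝ} (hω : 1 / 2 ≤ ω) {ν : ℕ} (hν : 1 ≤ ν) (hνω : 1 < (ν : ℝ) * ω) :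
    ContinuousOn (m (suzukiKernel ω ν)) (Ici 0) := by
  have hK : Continuous (suzukiKernel ω ν) := suzuki2021_prop41_iv (by linarith) ν hνω
  have hK0 : ∀ u : ℝ, u ≤ 0 → suzukiKernel ω ν u = 0 := (isSuzukiPair_zeta (by linarith) hν hνω).kernel_eq_zero
  intro t₀ ht₀
  have ht₀' : 0 ≤ t₀ := ht₀
  have hclean : ∀ s : ℝ, s ∈ Ico 0 (t₀ + 1) → NoUnitEigenvalue (suzukiKernel ω ν) s :=
    fun s hs => suzuki2021_windows_of_half_le' hω hν hνω hs.1
  exact continuousWithinAt_Ici_of_Ico (continuousOn_m_Ico hK hK0 hclean t₀ ⟨ht₀', by linarith⟩)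

/-- RH-FREE. `m′ = μ·m` at every `t > 0` for the `ζ` kernel (`ω ≥ ½`, `ν ≥ 1`, `νω > 1`). -/
theorem hasDerivAt_m_suzukiKernel {ω : ℝ} (hω : 1 / 2 ≤ ω) {ν : ℕ} (hν : 1 ≤ ν) (hνω : 1 < (ν : ℝ) * ω)
    (ht : 0 < t) :
    HasDerivAt (m (suzukiKernel ω ν)) (mu (suzukiKernel ω ν) t * m (suzukiKernel ω ν) t) t := by
  have hK : Continuous (suzukiKernel ω ν) := suzuki2021_prop41_iv (by linarith) ν hνω
  have hK0 : ∀ u : ℝ, u ≤ 0 → suzukiKernel ω ν u = 0 := (isSuzukiPair_zeta (by linarith) hν hνω).kernel_eq_zero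
  have hclean : ∀ s : ℝ, s ∈ Ico 0 (t + 1) → NoUnitEigenvalue (suzukiKernel ω ν) s :=
    fun s hs => suzuki2021_windows_of_half_le' hω hν hνω hs.1
  exact hasDerivAt_m hK hK0 hclean ⟨ht, by linarith⟩

/-- RH-FREE. The Hamiltonian `H_ζ^{ω,ν}` of (3.33) is continuous on `[0,∞)` (entrywise), `ω ≥ ½`, `ν ≥ 1`, `νω > 1`. -/
theorem continuousOn_hamiltonian_suzukiKernel {ω : ℝ} (hω : 1 / 2 ≤ ω) {ν : ℕ} (hν : 1 ≤ ν)
    (hνω : 1 < (ν : ℝ) * ω) (i j : Fin 2) :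
    ContinuousOn (fun t : ℝ => hamiltonian (suzukiKernel ω ν) t i j) (Ici 0) := by
  have hK : Continuous (suzukiKernel ω ν) := suzuki2021_prop41_iv (by linarith) ν hνω
  have hK0 : ∀ u : ℝ, u ≤ 0 → suzukiKernel ω ν u = 0 := (isSuzukiPair_zeta (by linarith) hν hνω).kernel_eq_zero
  intro t₀ ht₀
  have ht₀' : 0 ≤ t₀ := ht₀
  have hclean : ∀ s : ℝ, s ∈ Ico 0 (t₀ + 1) → NoUnitEigenvalue (suzukiKernel ω ν) s :=
    fun s hs => suzuki2021_windows_of_half_le' hω hν hνω hs.1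
  exact continuousWithinAt_Ici_of_Ico (continuousOn_hamiltonian_Ico hK hK0 hclean i j t₀ ⟨ht₀', by linarith⟩)

end Summit.RiemannHypothesis.RiemannHypothesis.Theorems.SuzukiStructureFunctions

end
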